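import Summits.CriticalPhenomena.CardyFormulaZ2.Theorems.CardyDualCurrentCanonicalLimitFromExactCRRealForm
import Summits.CriticalPhenomena.CardyFormulaZ2.Theorems.CardyDualCurrentTemplateCanonicalLimitTemplate

/-!
# Crux `CardyDualCurrent.CanonicalLimitFromExactCR` (stmt-CriticalPhenomena-11394): the lattice constant of the consequent is cosmetic

Line `registered`, lead c8 (cycle 9), a `--supports` remark on the SIZE half of the crux.

The consequent of the crux is verbatim the body of `TemplateCanonicalLimit` (r9): SOME template
`(r, m, z, s, g)` and SOME lattice constant `C > 0` with `θ_δ · C · δ^{-1/3} · G_{E δ} → q`.  Since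
template observables are linear in the local weights (`RealForm.obs_smul`: the observable of the
scaled template `RealForm.smul C T` is `C · T.obs`), the constant can be absorbed into the
template: `TemplateCanonicalLimit` is equivalent to its **unit-amplitude form**
(`templateCanonicalLimit_iff_unitAmplitude`) — some template whose observable, renormalised by
exactly `δ^{-1/3}` and unit phases, converges to `q` (stated inline, no new definition).  Hence the crux itself is equivalent to
`DualCurrentTemplateR → (unit-amplitude form)` (`canonicalLimitFromExactCR_iff_unitAmplitude`).

What this records for the planner (CYCLE9.md of the crux folder): at the level of the
existential consequent the "lattice constant `C`" carries no information; the entire amplitude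
content of the consequent is that `δ^{-1/3}` (with converging, not merely bounded, modulus) is the
right normaliser for SOME template — a sharp one-point law which the crux's stated proof shape
(Cauchy–Riemann ⇒ Morera ⇒ homogeneous spin-`1/3` Riemann–Hilbert uniqueness, which identifies
limits only up to a real factor, cf. `H_const` of the sibling crux stmt-11389) does not deliver;
for a FIXED template (the registered stub `stub_sizeCore`, universally quantified in `T`) the
constant is of course not removable.
-/

namespace Summit.CriticalPhenomena.CardyFormulaZ2.Cruxes.CanonicalLimitFromExactCR.Birth

open scoped Topology
open Filter Set Complex MeasureTheory
open Literature.Probability Literature.Probability.LatticeModels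
open Literature.Probability.RandomPlanarGeometry
open Summit.CriticalPhenomena.CardyFormulaZ2.Theses.CardyDualCurrent
  (DualCurrentTemplateR TemplateCanonicalLimit CanonicalLimitFromExactCR)
open Summit.CriticalPhenomena.CardyFormulaZ2.Theorems (templateCanonicalLimit_iff_template)

namespace Amplitude

/-- **The lattice constant is cosmetic in `TemplateCanonicalLimit`.** The item holds iff SOME
template has the canonical limit with lattice constant `1`: given `(T, C)`, the scaled template
`RealForm.smul C T` has observable `C · T.obs` (`RealForm.obs_smul`), so
`θ_δ · δ^{-1/3} · (C · T.obs) = θ_δ · C · δ^{-1/3} · T.obs`; conversely take `C = 1`. [folklore] -/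
theorem templateCanonicalLimit_iff_unitAmplitude :
    TemplateCanonicalLimit ↔
      ∃ T : LocalParafermionicTemplate,
      ∀ (D : DobrushinDomain) (E : ℝ → DiscreteDobrushin), ZdDiscretisationFamily D E →
      ∀ (φ : ConformalEquiv UpperHalfPlane.upperHalfPlaneSet D.carrier), D.IsChordalUniformizing φ →
      ∀ q : ℂ → ℂ, DifferentiableOn ℂ q D.carrier →
        (∀ w ∈ D.carrier, q w ^ 3 = deriv φ.symm w / φ.symm w) →
      ∃ θ : ℝ → ℂ, (∀ δ, ‖θ δ‖ = 1) ∧ ∀ i : Fin 2,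
        TendstoLocallyUniformlyOn
          (fun (δ : ℝ) (w : ℂ) => θ δ * ((δ ^ (-(1 / 3 : ℝ)) : ℝ) : ℂ) *
            T.obs (E δ) (fun j => ⌊(if j = 0 then w.re else w.im) / δ⌋) i)
          q (𝓝[>] (0 : ℝ)) D.carrier := by
  rw [templateCanonicalLimit_iff_template]
  constructor
  · rintro ⟨T, C, -, h⟩
    refine ⟨RealForm.smul C T, fun D E hE φ hφ q hq hq3 => ?_⟩
    obtain ⟨θ, hθ, hlim⟩ := h D E hE φ hφ q hq hq3
    refine ⟨θ, hθ, fun i => (hlim i).congr fun δ w _ => ?_⟩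
    rw [RealForm.obs_smul]
    ring
  · rintro ⟨T, h⟩
    refine ⟨T, 1, one_pos, fun D E hE φ hφ q hq hq3 => ?_⟩
    obtain ⟨θ, hθ, hlim⟩ := h D E hE φ hφ q hq hq3
    refine ⟨θ, hθ, fun i => (hlim i).congr fun δ w _ => ?_⟩
    push_cast
    ring

/-- **The crux in unit-amplitude form**: `CanonicalLimitFromExactCR` is equivalent to
"`DualCurrentTemplateR` implies that SOME template has the canonical limit with lattice constant
`1`" — its consequent is the body of `TemplateCanonicalLimit` (`Iff.rfl`), whose constant is
cosmetic (`templateCanonicalLimit_iff_unitAmplitude`). [folklore] -/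
theorem canonicalLimitFromExactCR_iff_unitAmplitude :
    CanonicalLimitFromExactCR ↔
      (DualCurrentTemplateR → ∃ T : LocalParafermionicTemplate,
        ∀ (D : DobrushinDomain) (E : ℝ → DiscreteDobrushin), ZdDiscretisationFamily D E →
        ∀ (φ : ConformalEquiv UpperHalfPlane.upperHalfPlaneSet D.carrier), D.IsChordalUniformizing φ →
        ∀ q : ℂ → ℂ, DifferentiableOn ℂ q D.carrier →
          (∀ w ∈ D.carrier, q w ^ 3 = deriv φ.symm w / φ.symm w) →
        ∃ θ : ℝ → ℂ, (∀ δ, ‖θ δ‖ = 1) ∧ ∀ i : Fin 2,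
          TendstoLocallyUniformlyOn
            (fun (δ : ℝ) (w : ℂ) => θ δ * ((δ ^ (-(1 / 3 : ℝ)) : ℝ) : ℂ) *
              T.obs (E δ) (fun j => ⌊(if j = 0 then w.re else w.im) / δ⌋) i)
            q (𝓝[>] (0 : ℝ)) D.carrier) := by
  have h : CanonicalLimitFromExactCR ↔ (DualCurrentTemplateR → TemplateCanonicalLimit) := Iff.rfl
  rw [h, templateCanonicalLimit_iff_unitAmplitude]

end Amplitude

end Summit.CriticalPhenomena.CardyFormulaZ2.Cruxes.CanonicalLimitFromExactCR.Birth
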